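import Summits.NavierStokesRegularity.FluidComputer.BlockRelVoid

/-!
# Block line — PRE-FIRING: the relative residue of the two-mode quadratic design is void on EVERY
# working region; the fifth typing ((T4a), (T4b) of R1-DESIGN §26.7) is dead before it is typed

HONEST FRAMING: low prior, high value-of-information experiment on Tao's machine paradigm; NOT a
claim that NS blows up. A NO-GO by the lane's own hand, of the kind of `BlockReachViscous` /
`BlockSubcritVoid` / `BlockRelVoid`: about the TYPING of the residue, not about Navier–Stokes.

MECHANISM (pre-firing). `BlockRelVoid` killed `RelOpenReachBound 𝒟 P (quadVF k η) (loadedRegion η)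
ε τc` by letting the output amplitude `b → ∞` in the junk-rate budget at the clean states `(0, b)`;
bounding `U` along the output axis ((T4a)) removes that limit — but finitely many clean states
already decide. At a clean state `p = (a, b) ∈ U` of block `n` the true trajectory pumps the
off-design mode `n+2` at the rate `D(p) = ⟨B(recon p, recon p), ψ_{n+2}⟩`, a quadratic polynomial
in `(a, b)` with `b²`-coefficient `E_{n+1} K`, `Re K = κ_{n+1}` (§1 `eulerForm_recon_recon`:
trilinearity of `eulerForm` on `H¹⁰`, symmetry); mode `n+2` is junk for block `n` with floor
weight `(2^{n+2}/λ_n)^s = 4^s`, and `BlockRelVoid`'s budget (`floor_mul_norm_eulerForm_recon_le`)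
caps `4^s ‖D(p)‖ ≤ 2(γ+1)√E_n/unit_n` at EVERY `p ∈ U`. A second difference in `b` over three
collinear clean states `(a, b), (a, b ± r) ∈ U` isolates the coefficient — the PUMP BUDGET
`4^s r² E_{n+1} κ_{n+1} ≤ 2(γ+1)√E_n·2/unit_n` (§3 `pump_budget_segment`). `BlockRelVoid`'s coupling
law at generation `n+1` (input ray in `U`, `(F (A,0)).2 = k A²`), `κ_{n+1} = k√E_{n+2}/(unit_{n+1}
E_{n+1})`, `√E_{n+2} = η√E_n`, turns it into the CLOCK-RATIO LAW `4^s r² k η · unit_n ≤ 4(γ+1) ·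
unit_{n+1}` (§3 `unit_step_of_budget`): per generation the clock may slow down at most by that
factor. It must instead SPEED UP geometrically, `unit_n τc ≤ Tmax_n = C λ₀^{-α} (2^{-α})ⁿ`
(`CascadeSpecs.Tmax_eq_geometric`); the squeeze of §2 (`geom_squeeze`) gives the PRE-FIRING
INEQUALITY (§3 `prefire_of_budget`; `jin + γ τc ≤ jrun`; `k, τc > 0`, `r ≠ 0`)

  `2^α · 4^s · r² · k · η ≤ 4 (γ+1) ≤ 4 ((jrun - jin)/τc + 1)`.

THE NO-GO (§4). A certificate from `AinO P` lives on `U ⊇ AinO P ⊇ AcoreO P = [aLo, ∞) × [-c0,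
c0]` (`Tube_zero`, `Tube_sub`; `ain_subset_of_cert`), which contains the input ray and the states
`(2, 0), (2, ±c0)`: `2^α 4^s c0² k η ≤ 4((jrun - jin)/τc + 1)` on EVERY admissible `U`. For
`Params.reg` (`s = 10`, `c0 = 3/20`, `jin = 1/2`, `jrun = 1`), `τc = 1`, `η ≥ 1/2`, `k ≥ 6` the
left side is `≥ 70778`, the right side `6`: `RelOpenReachBound 𝒟 (Params.reg) (quadVF k η) U ε 1`
is EMPTY for every `U ⊇ AcoreO` (`not_relOpenReachBound_reg_of_core`), in particular for (T4a)'s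
`loadedRegion η ∩ {b < bmax}` (`not_relOpenReachBound_quad_window`), and NO region carries both a
relative certificate from `AinO` and the relative residue (`relQuad_design_void`): the hypotheses
of a (T3-rel)-style assembly cannot be met by re-choosing `U`. (With `next_output : jrun ≤ c0 η 4^s`
the parameter-free form is `2^α · jrun · c0 · k ≤ 4(γ+1)` — output tolerance × coupling is capped
by the leak budget; recorded, not typed.) (T4b) (junk rate with the relative weight `1 + ‖p‖²`):
on those three states the weight is `< 6` and `70778 > 6·6`; the three consequences a typing of
(T4b) would supply — weighted budget, coupling, clock — are exactly the hypotheses of the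
abstract law `prefire_of_laws` (§2), so (T4b) is dead BEFORE it is typed. (T4c) (two-block
bookkeeping: mode `n+2` charged to block `n+1`, not to block `n`'s junk) is NOT refuted here — it
removes the pump from the junk budget. Pre-firing gives an ESTIMATE about it, no theorem:
during block `n`'s transit mode `n+2` is pre-loaded to relative amplitude `≈ 2^α k ∫b²`,
to be compared with block `n+1`'s spectator tolerance `c0` at hand-off, while a GRADUAL gate
(`ḃ = k a²` from `b = 0`) has `∫b² = O(1) ≫ c0/(2^α k)`. Design lesson if the line continues:
the pump into the next block must be SWITCHED (negligible until `b` is near hand-off, then fast)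
— Tao's abrupt gates — which two active modes with a quadratic monomial cannot express; the
minimal honest successor has a third active mode per block (a trigger) or a thresholded gate, AND
the two-block bookkeeping. DO NOT re-type (T4a)/(T4b); DO NOT attempt the positive residue.

CONTENTS (all [folklore]; elementary over `BlockRelVoid` §3–§4 and `eulerForm_add_smul₁`). §1 the
pump at a clean state as a polynomial, its second difference, cascade arithmetic; §2 the abstract
pre-firing calculus on real sequences; §3 budget, clock-ratio law and pre-firing inequality for
an inhabitant of `RelOpenReachBound`; §4 the no-go theorems.
-/

noncomputable section
open MeasureTheory Set Filter Topology Metric Asymptotics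
open scoped ENNReal NNReal

namespace Summit.NavierStokesRegularity.FluidComputer
open Literature.Analysis.FluidPDE Literature.Analysis.FluidPDE.Tao2016
open Literature.Analysis.FluidPDE.FluidComputer
open Literature.Analysis.FunctionSpaces (eFourierSobolevNorm)
open Summit.NavierStokesRegularity.NavierStokesRegularity.Theorems.FluidComputer
open Summit.NavierStokesRegularity.NavierStokesRegularity.Theorems.PerpetualPumpEulerTypeIGlue
  (eulerForm_smul_smul)

namespace BlockDesign

/-! ### §1. Two steps up the cascade; the pump at a general clean state -/

section TwoSteps

variable (𝒟 : CascadeWaveletData 1 1) (S : CascadeSpecs)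

/-- `√E_{n+2} = η √E_n` (`E_n = E₀ ηⁿ`, `η > 0`). [folklore] -/
theorem sqrt_Emin_add_two (n : ℕ) :
    Real.sqrt (S.Emin (n + 1 + 1)) = S.eta * Real.sqrt (S.Emin n) := by
  simp only [CascadeSpecs.Emin]
  rw [show S.E0 * S.eta ^ (n + 1 + 1) = S.eta ^ 2 * (S.E0 * S.eta ^ n) by ring,
    Real.sqrt_mul (sq_nonneg _), Real.sqrt_sq S.eta_pos.le]

/-- **The pump at a general clean state is a quadratic polynomial in the readout**:
`⟨B(recon n (a,b), recon n (a,b)), ψ_m⟩ = α² B₀₀ + 2αβ B₀₁ + β² B₁₁`, `α = a√E_n`, `β = b√E_{n+1}`,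
`B_ij = ⟨B(ψ_{n+i}, ψ_{n+j}), ψ_m⟩` (trilinearity on `H¹⁰`, symmetry). [folklore] -/
theorem eulerForm_recon_recon (n m : ℕ) (p : ℝ × ℝ) :
    eulerForm (recon 𝒟 S n p) (recon 𝒟 S n p) (mode 𝒟 m) =
      ((p.1 * Real.sqrt (S.Emin n) : ℝ) : ℂ) ^ 2 * eulerForm (mode 𝒟 n) (mode 𝒟 n) (mode 𝒟 m) +
      2 * ((p.1 * Real.sqrt (S.Emin n) : ℝ) : ℂ) * ((p.2 * Real.sqrt (S.Emin (n + 1)) : ℝ) : ℂ) *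
        eulerForm (mode 𝒟 n) (mode 𝒟 (n + 1)) (mode 𝒟 m) +
      ((p.2 * Real.sqrt (S.Emin (n + 1)) : ℝ) : ℂ) ^ 2 *
        eulerForm (mode 𝒟 (n + 1)) (mode 𝒟 (n + 1)) (mode 𝒟 m) := by
  have h0 : MemH10df (mode 𝒟 n) := 𝒟.memH10df_cascadeWavelet two_pos' 0 (n : ℤ)
  have h1 : MemH10df (mode 𝒟 (n + 1)) := 𝒟.memH10df_cascadeWavelet two_pos' 0 ((n + 1 : ℕ) : ℤ)
  set α : ℝ := p.1 * Real.sqrt (S.Emin n) with hα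
  set β : ℝ := p.2 * Real.sqrt (S.Emin (n + 1)) with hβ
  have hx : eFourierSobolevNorm 10 (((α : ℝ) : ℂ) • mode 𝒟 n) < ∞ := (h0.smul α).1
  have hrec : recon 𝒟 S n p = ((α : ℝ) : ℂ) • mode 𝒟 n + ((β : ℝ) : ℂ) • mode 𝒟 (n + 1) := rfl
  have hxy : eFourierSobolevNorm 10 (((α : ℝ) : ℂ) • mode 𝒟 n + ((β : ℝ) : ℂ) • mode 𝒟 (n + 1))
      < ∞ := hrec ▸ (memH10df_recon 𝒟 S n p).1
  rw [hrec, eulerForm_add_smul₁ _ _ hx h1.1 hxy,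
    eulerForm_symm (((α : ℝ) : ℂ) • mode 𝒟 n) (((α : ℝ) : ℂ) • mode 𝒟 n + _),
    eulerForm_symm (mode 𝒟 (n + 1)) (((α : ℝ) : ℂ) • mode 𝒟 n + _),
    eulerForm_add_smul₁ _ _ hx h1.1 hx, eulerForm_add_smul₁ _ _ hx h1.1 h1.1, eulerForm_smul_smul,
    eulerForm_symm (mode 𝒟 (n + 1)) (((α : ℝ) : ℂ) • mode 𝒟 n), eulerForm_smul₁]
  ring

/-- **Second difference along the output direction** isolates the `b²`-coefficient:
`D(a,b+r) + D(a,b-r) - 2 D(a,b) = 2 r² E_{n+1} ⟨B(ψ_{n+1},ψ_{n+1}),ψ_m⟩`. [folklore] -/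
theorem eulerForm_recon_second_diff (n m : ℕ) (a b r : ℝ) :
    eulerForm (recon 𝒟 S n (a, b + r)) (recon 𝒟 S n (a, b + r)) (mode 𝒟 m) +
        eulerForm (recon 𝒟 S n (a, b - r)) (recon 𝒟 S n (a, b - r)) (mode 𝒟 m) -
        2 * eulerForm (recon 𝒟 S n (a, b)) (recon 𝒟 S n (a, b)) (mode 𝒟 m) =
      ((2 * (r * Real.sqrt (S.Emin (n + 1))) ^ 2 : ℝ) : ℂ) *
        eulerForm (mode 𝒟 (n + 1)) (mode 𝒟 (n + 1)) (mode 𝒟 m) := by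
  simp only [eulerForm_recon_recon]
  push_cast
  ring

variable {S}

/-- The junk floor weight of mode `n+2` seen from block `n` is `(2^{n+2}/λ_n)^s = 4^s`
(`λ_n = 2ⁿ`). [folklore] -/
theorem floor_two_rpow (P : Params S) (n : ℕ) :
    ((2 : ℝ) ^ (n + 1 + 1) / S.lam n) ^ P.s = (4 : ℝ) ^ P.s := by
  have h : (2 : ℝ) ^ (n + 1 + 1) / S.lam n = 4 := by
    rw [P.lam_eq, pow_succ, pow_succ]; field_simp; norm_num
  rw [h]

end TwoSteps

/-! ### §2. The abstract pre-firing calculus (real sequences only) -/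

section Calculus

/-- **One step**: a pump budget with weight `w`, `M (c² E₁ κ₁) ≤ 2 (γ+1) sE w / u₀`, and the
coupling law `κ₁ = k (η sE) / (u₁ E₁)` give `M c² k η u₀ ≤ 2 (γ+1) w u₁`. [folklore] -/
theorem step_of_laws {M c k η sE u₀ u₁ E₁ γ w : ℝ} (hu₀ : 0 < u₀) (hu₁ : 0 < u₁)
    (hE₁ : 0 < E₁) (hsE : 0 < sE)
    (h : M * (c ^ 2 * E₁ * (k * (η * sE) / (u₁ * E₁))) ≤ 2 * ((γ + 1) * sE * w / u₀)) :
    M * c ^ 2 * k * η * u₀ ≤ 2 * (γ + 1) * w * u₁ := by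
  have h1 : M * (c ^ 2 * E₁ * (k * (η * sE) / (u₁ * E₁)))
      = (M * c ^ 2 * k * η * u₀) * (sE / (u₀ * u₁)) := by field_simp
  have h2 : 2 * ((γ + 1) * sE * w / u₀) = (2 * (γ + 1) * w * u₁) * (sE / (u₀ * u₁)) := by field_simp
  rw [h1, h2] at h
  exact le_of_mul_le_mul_right h (by positivity)

/-- **Geometric squeeze**: a positive sequence with `c uₙ ≤ d uₙ₊₁` (`c, d > 0`) and
`uₙ τ ≤ C (g⁻¹)ⁿ` (`τ, g > 0`) has `g c ≤ d` (else `uₙ ≥ u₀ (c/d)ⁿ` and `(g c/d)ⁿ u₀ τ ≤ C` for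
all `n` with `g c/d > 1`). [folklore] -/
theorem geom_squeeze {u : ℕ → ℝ} {c d C τ g : ℝ} (hu : ∀ n, 0 < u n) (hc : 0 < c)
    (hd : 0 < d) (hτ : 0 < τ) (hg : 0 < g) (hstep : ∀ n, c * u n ≤ d * u (n + 1))
    (hclock : ∀ n, u n * τ ≤ C * (g⁻¹) ^ n) : g * c ≤ d := by
  by_contra hlt
  rw [not_le] at hlt
  set x := g * c / d with hx
  have hx1 : 1 < x := by rw [hx, lt_div_iff₀ hd]; linarith
  have hind : ∀ n, u 0 * (c / d) ^ n ≤ u n := by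
    intro n
    induction n with
    | zero => simp
    | succ n ih =>
      have h' : c / d * u n ≤ u (n + 1) := by
        rw [div_mul_eq_mul_div, div_le_iff₀ hd]; linarith [hstep n]
      calc u 0 * (c / d) ^ (n + 1) = c / d * (u 0 * (c / d) ^ n) := by ring
        _ ≤ c / d * u n := mul_le_mul_of_nonneg_left ih (by positivity)
        _ ≤ u (n + 1) := h'
  have hbound : ∀ n, u 0 * τ * x ^ n ≤ C := by
    intro n
    have hgn : 0 < g ^ n := pow_pos hg n
    have hxn : x ^ n = (c / d) ^ n * g ^ n := by
      rw [hx, ← mul_pow]; congr 1; field_simp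
    calc u 0 * τ * x ^ n = (u 0 * (c / d) ^ n * τ) * g ^ n := by rw [hxn]; ring
      _ ≤ (u n * τ) * g ^ n :=
          mul_le_mul_of_nonneg_right (mul_le_mul_of_nonneg_right (hind n) hτ.le) hgn.le
      _ ≤ (C * (g⁻¹) ^ n) * g ^ n := mul_le_mul_of_nonneg_right (hclock n) hgn.le
      _ = C := by rw [inv_pow, mul_assoc, inv_mul_cancel₀ hgn.ne', mul_one]
  obtain ⟨n, hn⟩ := pow_unbounded_of_one_lt (C / (u 0 * τ)) hx1
  rw [div_lt_iff₀ (mul_pos (hu 0) hτ)] at hn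
  linarith [hbound n]

/-- **THE PRE-FIRING LAW, abstract form** — all a typing of the residue supplies: clock `u`,
coefficients `κ`, energies `E`, `sE = √E` with `sE (n+2) = η sE n`; per generation a pump budget
with weight `w`, `M (c² E_{n+1} κ_{n+1}) ≤ 2 (γ+1) sE_n w / u_n`, the coupling law
`k = u_n E_n κ_n / sE_{n+1}`, the clock bound `u_n τ ≤ C (g⁻¹)ⁿ`. Then `g M c² k η ≤ 2 (γ+1) w`
(this file: `w = 2`; (T4b): `w` = a bound of the relative weight on the three states). [folklore] -/
theorem prefire_of_laws {u κ E sE : ℕ → ℝ} {M c k η γ w C τ g : ℝ}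
    (hu : ∀ n, 0 < u n) (hE : ∀ n, 0 < E n) (hsE : ∀ n, 0 < sE n)
    (hsE2 : ∀ n, sE (n + 1 + 1) = η * sE n) (hM : 0 < M) (hc : c ≠ 0) (hk : 0 < k) (hη : 0 < η)
    (hγ : 0 ≤ γ) (hw : 0 < w) (hτ : 0 < τ) (hg : 0 < g)
    (hbudget : ∀ n, M * (c ^ 2 * E (n + 1) * κ (n + 1)) ≤ 2 * ((γ + 1) * sE n * w / u n))
    (hcoupling : ∀ n, k = u n * E n * κ n / sE (n + 1))
    (hclock : ∀ n, u n * τ ≤ C * (g⁻¹) ^ n) :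
    g * (M * c ^ 2 * k * η) ≤ 2 * (γ + 1) * w := by
  refine geom_squeeze hu (by positivity) (by positivity) hτ hg (fun n => ?_) hclock
  have hκ : κ (n + 1) = k * (η * sE n) / (u (n + 1) * E (n + 1)) := by
    rw [hcoupling (n + 1), hsE2]
    field_simp [(hu (n + 1)).ne', (hE (n + 1)).ne', (hsE n).ne', hη.ne']
  have h := hbudget n; rw [hκ] at h
  exact step_of_laws (hu n) (hu (n + 1)) (hE (n + 1)) (hsE n) h

end Calculus

/-! ### §3. Budgets and the pre-firing inequality for an inhabitant of `RelOpenReachBound` -/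

section Laws

variable {𝒟 : CascadeWaveletData 1 1} {S : CascadeSpecs} {P : Params S}
variable {F : ℝ × ℝ → ℝ × ℝ} {U : Set (ℝ × ℝ)} {ε τc : ℝ}

/-- `κ_{n+1} ≤ ‖⟨B(ψ_{n+1},ψ_{n+1}),ψ_{n+2}⟩‖` (`Re ≤ ‖·‖`). [folklore] -/
theorem fwdCoef_le_norm (𝒟 : CascadeWaveletData 1 1) (n : ℕ) :
    fwdCoef 𝒟 (n + 1) ≤ ‖eulerForm (mode 𝒟 (n + 1)) (mode 𝒟 (n + 1)) (mode 𝒟 (n + 1 + 1))‖ :=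
  (le_abs_self _).trans (Complex.abs_re_le_norm _)

/-- **THE PUMP BUDGET from three collinear clean states** `(a, b)`, `(a, b ± r)` in `U` (second
difference of `BlockRelVoid`'s budget; weight `2`):
`4^s (r² E_{n+1} κ_{n+1}) ≤ 2 (γ+1) √E_n · 2 / unit_n`. [folklore] -/
theorem RelOpenReachBound.pump_budget_segment (H : RelOpenReachBound 𝒟 P F U ε τc) (n : ℕ)
    {a b r : ℝ} (h0 : ((a, b) : ℝ × ℝ) ∈ U) (hp : ((a, b + r) : ℝ × ℝ) ∈ U)
    (hm : ((a, b - r) : ℝ × ℝ) ∈ U) :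
    (4 : ℝ) ^ P.s * (r ^ 2 * S.Emin (n + 1) * fwdCoef 𝒟 (n + 1)) ≤
      2 * ((H.γ + 1) * Real.sqrt (S.Emin n) * 2 / H.unit n) := by
  have b0 := H.floor_mul_norm_eulerForm_recon_le n (m := n + 1 + 1) (by omega) (by omega) h0
  have bp := H.floor_mul_norm_eulerForm_recon_le n (m := n + 1 + 1) (by omega) (by omega) hp
  have bm := H.floor_mul_norm_eulerForm_recon_le n (m := n + 1 + 1) (by omega) (by omega) hm
  rw [floor_two_rpow] at b0 bp bm
  set M : ℝ := (4 : ℝ) ^ P.s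
  have hM0 : 0 ≤ M := Real.rpow_nonneg (by norm_num) _
  have hsd := eulerForm_recon_second_diff 𝒟 S n (n + 1 + 1) a b r
  set B := eulerForm (mode 𝒟 (n + 1)) (mode 𝒟 (n + 1)) (mode 𝒟 (n + 1 + 1))
  set Dp := eulerForm (recon 𝒟 S n (a, b + r)) (recon 𝒟 S n (a, b + r)) (mode 𝒟 (n + 1 + 1))
  set Dm := eulerForm (recon 𝒟 S n (a, b - r)) (recon 𝒟 S n (a, b - r)) (mode 𝒟 (n + 1 + 1))
  set D0 := eulerForm (recon 𝒟 S n (a, b)) (recon 𝒟 S n (a, b)) (mode 𝒟 (n + 1 + 1))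
  have htri : ‖Dp + Dm - 2 * D0‖ ≤ ‖Dp‖ + ‖Dm‖ + 2 * ‖D0‖ :=
    calc ‖Dp + Dm - 2 * D0‖ ≤ ‖Dp + Dm‖ + ‖2 * D0‖ := norm_sub_le _ _
      _ ≤ ‖Dp‖ + ‖Dm‖ + ‖2 * D0‖ := add_le_add (norm_add_le _ _) le_rfl
      _ = ‖Dp‖ + ‖Dm‖ + 2 * ‖D0‖ := by rw [norm_mul, Complex.norm_two]
  have key : M * ‖(((2 * (r * Real.sqrt (S.Emin (n + 1))) ^ 2 : ℝ)) : ℂ) * B‖ ≤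
      4 * (2 * ((H.γ + 1) * Real.sqrt (S.Emin n) / H.unit n)) := by
    rw [← hsd]
    calc M * ‖Dp + Dm - 2 * D0‖ ≤ M * (‖Dp‖ + ‖Dm‖ + 2 * ‖D0‖) :=
          mul_le_mul_of_nonneg_left htri hM0
      _ = M * ‖Dp‖ + M * ‖Dm‖ + 2 * (M * ‖D0‖) := by ring
      _ ≤ _ := by linarith
  rw [norm_mul, Complex.norm_real, Real.norm_eq_abs, abs_of_nonneg (by positivity), mul_pow,
    Real.sq_sqrt (S.Emin_pos _).le,
    show M * (2 * (r ^ 2 * S.Emin (n + 1)) * ‖B‖) = 2 * (M * (r ^ 2 * S.Emin (n + 1) * ‖B‖)) by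
      ring] at key
  have hre := mul_le_mul_of_nonneg_left (mul_le_mul_of_nonneg_left (fwdCoef_le_norm 𝒟 n)
    (mul_nonneg (sq_nonneg r) (S.Emin_pos (n + 1)).le)) hM0
  rw [show (2 : ℝ) * ((H.γ + 1) * Real.sqrt (S.Emin n) * 2 / H.unit n) =
    4 * (2 * ((H.γ + 1) * Real.sqrt (S.Emin n) / H.unit n)) / 2 by ring]
  linarith

/-- **THE CLOCK-RATIO LAW**: the input ray `{(A,0) : A ≥ A₀} ⊆ U` with `(F (A,0)).2 = k A²`
there (coupling law at `n+1`) and a pump budget with weight `w` give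
`4^s c² k η · unit_n ≤ 2 (γ+1) w · unit_{n+1}` for every `n`. [folklore] -/
theorem RelOpenReachBound.unit_step_of_budget (H : RelOpenReachBound 𝒟 P F U ε τc) {A₀ k : ℝ}
    (hU : ∀ A : ℝ, A₀ ≤ A → ((A, 0) : ℝ × ℝ) ∈ U)
    (hF : ∀ A : ℝ, A₀ ≤ A → (F (A, 0)).2 = k * A ^ 2) {c w : ℝ}
    (hB : ∀ n, (4 : ℝ) ^ P.s * (c ^ 2 * S.Emin (n + 1) * fwdCoef 𝒟 (n + 1)) ≤
      2 * ((H.γ + 1) * Real.sqrt (S.Emin n) * w / H.unit n)) (n : ℕ) :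
    (4 : ℝ) ^ P.s * c ^ 2 * k * S.eta * H.unit n ≤ 2 * (H.γ + 1) * w * H.unit (n + 1) := by
  have hκ : fwdCoef 𝒟 (n + 1) =
      k * (S.eta * Real.sqrt (S.Emin n)) / (H.unit (n + 1) * S.Emin (n + 1)) := by
    rw [H.coupling_eq (n + 1) hU hF, sqrt_Emin_add_two]
    field_simp [(H.unit_pos (n + 1)).ne', (S.Emin_pos (n + 1)).ne', (sqrt_Emin_pos S n).ne',
      S.eta_pos.ne']
  have h := hB n
  rw [hκ] at h
  exact step_of_laws (H.unit_pos n) (H.unit_pos (n + 1)) (S.Emin_pos (n + 1)) (sqrt_Emin_pos S n) h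

/-- **THE PRE-FIRING INEQUALITY**: under the hypotheses of `unit_step_of_budget` with `c ≠ 0`,
`k > 0`, `w > 0`, `τc > 0`: `2^α · (4^s c² k η) ≤ 2 (γ+1) w ≤ 2 w ((jrun - jin)/τc + 1)` — clock law
`unit_n τc ≤ C λ₀^{-α} (2^{-α})ⁿ`, geometric squeeze, `jin + γ τc ≤ jrun`. [folklore] -/
theorem RelOpenReachBound.prefire_of_budget (H : RelOpenReachBound 𝒟 P F U ε τc) {A₀ k : ℝ}
    (hU : ∀ A : ℝ, A₀ ≤ A → ((A, 0) : ℝ × ℝ) ∈ U)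
    (hF : ∀ A : ℝ, A₀ ≤ A → (F (A, 0)).2 = k * A ^ 2) {c w : ℝ}
    (hB : ∀ n, (4 : ℝ) ^ P.s * (c ^ 2 * S.Emin (n + 1) * fwdCoef 𝒟 (n + 1)) ≤
      2 * ((H.γ + 1) * Real.sqrt (S.Emin n) * w / H.unit n))
    (hc : c ≠ 0) (hk : 0 < k) (hw : 0 < w) (hτ : 0 < τc) :
    (2 : ℝ) ^ S.alpha * ((4 : ℝ) ^ P.s * c ^ 2 * k * S.eta) ≤ 2 * (H.γ + 1) * w ∧
      (2 : ℝ) ^ S.alpha * ((4 : ℝ) ^ P.s * c ^ 2 * k * S.eta) ≤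
        2 * w * ((P.jrun - P.jin) / τc + 1) := by
  have hc0 : 0 < (4 : ℝ) ^ P.s * c ^ 2 * k * S.eta :=
    mul_pos (mul_pos (mul_pos (Real.rpow_pos_of_pos (by norm_num) _) (by positivity)) hk)
      S.eta_pos
  have hd : 0 < 2 * (H.γ + 1) * w := by have := H.γ_nonneg; positivity
  have h1 : (2 : ℝ) ^ S.alpha * ((4 : ℝ) ^ P.s * c ^ 2 * k * S.eta) ≤ 2 * (H.γ + 1) * w := by
    refine geom_squeeze (C := S.C * S.lam0 ^ (-S.alpha)) H.unit_pos hc0 hd hτ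
      (Real.rpow_pos_of_pos two_pos S.alpha) (H.unit_step_of_budget hU hF hB) fun n => ?_
    have h := H.clock n
    rw [S.Tmax_eq_geometric, Real.rpow_neg zero_le_two S.alpha] at h
    exact h
  have hγ : H.γ ≤ (P.jrun - P.jin) / τc := by
    rw [le_div_iff₀ hτ]; linarith [H.jrun_ge]
  exact ⟨h1, h1.trans (by nlinarith [hw])⟩

end Laws

/-! ### §4. The no-go: every working region containing the core window is void -/

section NoGo

variable {𝒟 : CascadeWaveletData 1 1} {S : CascadeSpecs} {P : Params S} {k η ε τc : ℝ}

/-- **Segment form**: if `U` contains an input ray and three collinear clean states `(a, b)`,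
`(a, b ± r)` with `4 ((jrun - jin)/τc + 1) < 4^s r² k η` (`k > 0`, `τc > 0`, `α ≥ 0`), then
`RelOpenReachBound 𝒟 P (quadVF k η) U ε τc` is EMPTY. [folklore] -/
theorem not_relOpenReachBound_quad_of_segment (hα : 0 ≤ S.alpha) (hk : 0 < k) (hτ : 0 < τc)
    {U : Set (ℝ × ℝ)} {A₀ a b r : ℝ} (hU : ∀ A : ℝ, A₀ ≤ A → ((A, 0) : ℝ × ℝ) ∈ U)
    (h0 : ((a, b) : ℝ × ℝ) ∈ U) (hp : ((a, b + r) : ℝ × ℝ) ∈ U) (hm : ((a, b - r) : ℝ × ℝ) ∈ U)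
    (hbig : 4 * ((P.jrun - P.jin) / τc + 1) < (4 : ℝ) ^ P.s * r ^ 2 * k * S.eta) :
    IsEmpty (RelOpenReachBound 𝒟 P (quadVF k η) U ε τc) := by
  refine ⟨fun H => ?_⟩
  have hr0 : r ≠ 0 := by
    rintro rfl
    have : (4 : ℝ) ^ P.s * (0 : ℝ) ^ 2 * k * S.eta = 0 := by ring
    linarith [div_nonneg (sub_nonneg.2 P.jin_le_jrun) hτ.le]
  have h := (H.prefire_of_budget hU (fun A _ => by simp [quadVF])
    (fun n => H.pump_budget_segment n h0 hp hm) hr0 hk two_pos hτ).2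
  have hc : 0 ≤ (4 : ℝ) ^ P.s * r ^ 2 * k * S.eta :=
    mul_nonneg (mul_nonneg (mul_nonneg (Real.rpow_nonneg (by norm_num) _) (sq_nonneg _)) hk.le)
      S.eta_pos.le
  have h1 : (4 : ℝ) ^ P.s * r ^ 2 * k * S.eta ≤
      (2 : ℝ) ^ S.alpha * ((4 : ℝ) ^ P.s * r ^ 2 * k * S.eta) :=
    le_mul_of_one_le_left hc (Real.one_le_rpow one_le_two hα)
  linarith

/-- **NO-GO FOR EVERY WORKING REGION CONTAINING THE CORE WINDOW**: for `Params.reg` (`c0 = 3/20`,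
`aLo = 3/2`), `k ≥ 6`, `η = S.eta ≥ 1/2`, `α ≥ 0`, `τc = 1`, and ANY `U ⊇ AcoreO (Params.reg)`
(input ray `A ≥ 3/2`; states `(2, 0)`, `(2, ±3/20)`): `6 < 4^{10} (3/20)² · 6 · (1/2)`, so
`RelOpenReachBound 𝒟 (Params.reg) (quadVF k η) U ε 1` is EMPTY. [folklore] -/
theorem not_relOpenReachBound_reg_of_core (hS : S.lam0 = 1) (hη : 1 / 2 ≤ S.eta)
    (hα : 0 ≤ S.alpha) (hk : 6 ≤ k) {U : Set (ℝ × ℝ)} (hU : AcoreO (Params.reg S hS hη) ⊆ U) :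
    IsEmpty (RelOpenReachBound 𝒟 (Params.reg S hS hη) (quadVF k S.eta) U ε 1) := by
  have hk0 : (0 : ℝ) < k := by linarith
  have hs : (Params.reg S hS hη).s = 10 := rfl
  have hji : (Params.reg S hS hη).jin = 1 / 2 := rfl
  have hjr : (Params.reg S hS hη).jrun = 1 := rfl
  have mem : ∀ A b : ℝ, 3 / 2 ≤ A → -(3 / 20) ≤ b → b ≤ 3 / 20 → ((A, b) : ℝ × ℝ) ∈ U :=
    fun A b hA hb1 hb2 => hU (by
      simp only [AcoreO, Params.reg, Set.mem_prod, Set.mem_Ici, Set.mem_Icc]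
      exact ⟨hA, hb1, hb2⟩)
  refine not_relOpenReachBound_quad_of_segment hα hk0 one_pos (A₀ := 3 / 2) (a := 2) (b := 0)
    (r := 3 / 20) (fun A hA => mem A 0 hA (by norm_num) (by norm_num))
    (mem 2 0 (by norm_num) (by norm_num) (by norm_num))
    (mem 2 _ (by norm_num) (by norm_num) (by norm_num))
    (mem 2 _ (by norm_num) (by norm_num) (by norm_num)) ?_
  rw [hs, hji, hjr, four_rpow_ten]
  nlinarith [mul_le_mul hk hη (by norm_num) (by positivity)]

/-- **NO-GO ((T4a) as proposed in R1-DESIGN §26.7)**: the working region bounded along the output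
axis, `U = loadedRegion η ∩ {p | p.2 < bmax}` (`bmax > 3/20`), contains the core window
(`a ≥ 3/2 ⇒ a² + η b² > 2`); so for `Params.reg`, `k ≥ 6`, `η = S.eta ≥ 1/2`, `α ≥ 0`, `τc = 1`
the structure `RelOpenReachBound 𝒟 (Params.reg) (quadVF k η) U ε 1` is EMPTY. About the TYPING,
not about NS. [folklore] -/
theorem not_relOpenReachBound_quad_window (hS : S.lam0 = 1) (hη : 1 / 2 ≤ S.eta)
    (hα : 0 ≤ S.alpha) (hk : 6 ≤ k) {bmax : ℝ} (hbm : 3 / 20 < bmax) :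
    IsEmpty (RelOpenReachBound 𝒟 (Params.reg S hS hη) (quadVF k S.eta)
      (loadedRegion S.eta ∩ {p | p.2 < bmax}) ε 1) := by
  refine not_relOpenReachBound_reg_of_core hS hη hα hk fun p hp => ?_
  simp only [AcoreO, Params.reg, Set.mem_prod, Set.mem_Ici, Set.mem_Icc] at hp
  refine ⟨?_, show p.2 < bmax by linarith [hp.2.2]⟩
  show 2 < pairEnergy S.eta p
  unfold pairEnergy
  nlinarith [mul_nonneg S.eta_pos.le (sq_nonneg p.2), hp.1]

/-- A relative certificate from `Ain` keeps `Ain` inside `U` (`Tube_zero`/`Tube_sub`). [folklore] -/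
theorem ain_subset_of_cert {F : ℝ × ℝ → ℝ × ℝ} {U : Set (ℝ × ℝ)}
    {ω : ℝ × ℝ → ℝ} {Ain Aout : Set (ℝ × ℝ)} (c : RelReachCertificate F U ω τc Ain Aout)
    (hτ : 0 ≤ τc) : Ain ⊆ U :=
  fun p hp => c.Tube_sub p hp 0 ⟨le_rfl, hτ⟩ (c.Tube_zero p hp)

/-- **THE TWO-MODE QUADRATIC DESIGN HAS NO RELATIVE RESIDUE ON ANY REGION**: for `Params.reg`,
`k ≥ 6`, `η = S.eta ≥ 1/2`, `α ≥ 0`, `τc = 1`, a working region `U` that carries a relative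
certificate from `AinO (Params.reg)` (any modulus, any target; `AinO ⊇ AcoreO`) carries NO
inhabitant of `RelOpenReachBound 𝒟 (Params.reg) (quadVF k η) U ε 1`: the two hypotheses of a
(T3-rel)-style assembly cannot be met together by re-choosing `U`. About the TYPING, not about
NS. [folklore] -/
theorem relQuad_design_void (hS : S.lam0 = 1) (hη : 1 / 2 ≤ S.eta) (hα : 0 ≤ S.alpha)
    (hk : 6 ≤ k) {U : Set (ℝ × ℝ)} {ω : ℝ × ℝ → ℝ} {Aout : Set (ℝ × ℝ)}
    (c : RelReachCertificate (quadVF k S.eta) U ω 1 (AinO (Params.reg S hS hη)) Aout) :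
    IsEmpty (RelOpenReachBound 𝒟 (Params.reg S hS hη) (quadVF k S.eta) U ε 1) :=
  not_relOpenReachBound_reg_of_core hS hη hα hk fun p hp =>
    ain_subset_of_cert c zero_le_one (core_thickO p hp (Metric.mem_ball_self (Params.δ_pos _)))

end NoGo

end BlockDesign

end Summit.NavierStokesRegularity.FluidComputer
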